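import Summits.ValiantsHypothesis.ValiantsHypothesis.Theses.PolyaContinued

/-!
# Crux `MonotoneCoverHard` (stmt-ValiantsHypothesis-7421, route PolyaContinued, rank 2) — skeleton of
line `few-state-cut`

Registered line (D-0145) on item 7421, filed by planner val-width-lines-1 g0 (2026-08-27).  The skeleton is
the strategist's BC3 birth skeleton (planner cstrat-7420, 2026-08-17, `Cruxes/PfaffianCoverHard/Lines/
birth_MonotoneCoverHard.lean`, evidence on 7421) RE-HOMED verbatim under the crux's own directory and
namespace so that its two stubs are registered on 7421 and provers can land them `--supports
stmt-ValiantsHypothesis-7421` by name; the mathematics, the stub statements and the kernel-checked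
composition are the strategist's.  RESHAPE 2026-08-27 (prover val-width-7421-p2 g0): the registered
`stub_fewStateCut` was refuted AS STATED at `n = 1` (`Theorems/MonotoneCoverHard/Negative/FewStateCutStubFalse.lean`,
`stub_fewStateCut_false`, p576551: the balance window `[n/3, 2n/3]` is integer-free at `n = 1` while the
`1 × 1` cover of `per_1` satisfies every hypothesis); it now carries a uniform threshold `∃ c n₀, ∀ n ≥ n₀`
and `MonotoneCoverHard_of` absorbs `n₀` into `K`; `stub_rectangleBound` is byte-identical.  CALIBRATION: `MonotoneCoverHard` is OPEN and strictly weaker than the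
route target `PfaffianCoverHard` (≡ DetQP.DetqpThesis, VNP ⊄ VQP); the known floor for label-bijective covers
is the rank/rectangle bound `m ≳ n²` (cf. dc(per_n) ≥ n²/2); the line's bet (`stub_fewStateCut`) is a
NON-rank structural statement.  Proving the crux closes item 7421 only; together with `CoverDecancellation`
(17819) it would give `PfaffianCoverHard` (glue 18009, `monotone_split`).  VP ≠ VNP is not moved by this file.

`MonotoneCoverHard`: no quasi-polynomial Pfaffian bipartite graph `E ⊆ Fin m × Fin m` with edges labelled
by variables of `per_n` or the constants `0, 1` has `per_n = PM_E(labels)` — equivalently (positivity: no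
cancellation is possible among monomials with coefficient `1`) its perfect matchings avoiding the `0`-edges are
in LABEL-BIJECTION with `S_n`. The line makes the route header's "rectangles from cuts" mechanism explicit and
isolates exactly what must be NEW:

* `stub_fewStateCut` (THINNESS OF BIJECTIVE COVERS — the bet, XL): uniformly (`∃ c n₀`, for all `n ≥ n₀` —
  threshold added 2026-08-27 after the `n = 1` refutation of the threshold-free registration), every label-bijective
  Pfaffian cover of `S_n` on `m + m` vertices has a BALANCED vertex cut `S` (every perfect matching has between
  `n/3` and `2n/3` of its labelled edges inside `S`) with FEW MATCHING STATES: the number of distinct sets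
  `M ∩ ∂S` over perfect matchings `M` is `≤ 2^((log₂ m + c)^c)`. True for every cover we know (ABP split
  graphs such as Grenet's `2^n − 1` cover and the permutation decision tree: tight cuts, `≤ m²` states);
  the content is that PLANAR / Pfaffian braces cannot route a balanced share of a permutation's information
  through a wide front — the natural grid encoding of `S_n` (wires = unused values, one selection per row)
  needs the 4-ary cell relation `{1100, 1010, 0000, 0101, 1111}`, which violates the arity-4 matchgate
  identity (`1·1 + 1·1 ≠ 0`), a first instance of the "global no-planarizing-gadget" phenomenon
  (GKMST, doi:10.1145/2934310; Valiant 2002 matchgates; Cai–Gorenstein doi:10.4086/toc.2014.v010a007).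
  Why it might fail: a grid-like Pfaffian cover whose balanced cuts all have `2^{m^ε}` states yet whose
  matchings biject onto `S_n` — none is known; finding one for small `n` is the cheapest falsifier.
* `stub_rectangleBound` (RECTANGLE COUNTING, provable now, M–L): in a label-bijective Pfaffian cover of `S_n`,
  a balanced cut with `N` states forces `2^(n/3) ≤ N`: matchings with a fixed state `F ⊆ ∂S` form a
  combinatorial rectangle `A_F × B_F` whose label sets use fixed row/column sets, so `|A_F × B_F| ≤ k!(n-k)!`
  with `n/3 ≤ k ≤ 2n/3`, and `n! ≤ N · max_k k!(n-k)!` gives `N ≥ C(n, ⌈n/3⌉) ≥ 2^(n/3)`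
  (Jerrum–Snir-type content/rectangle counting; the tight-cut case is the classical `m ≥ C(n, n/2)` bound
  for monotone ABPs).

`MonotoneCoverHard_of` (no sorry outside the stubs): for a quasi-polynomial cover family (exponent `c₀`) take
`n = 2^t`, `t = 4K² + 8K + 4`, `K = (c₀ + 2)c + c₀ + c + 2`; the two stubs give
`2^(n/3) ≤ N ≤ 2^((log₂ m + c)^c) ≤ 2^((t + K)^K)` (`decancellation_exponent_le`), i.e. `2^t / 3 ≤ (t + K)^K`,
contradicting the elementary `polylog_lt_linear : (t + K)^K < 2^t / 3`.
-/

set_option linter.dupNamespace false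

namespace Summit.ValiantsHypothesis.ValiantsHypothesis.Cruxes.MonotoneCoverHard.FewStateCut

open Literature.Computability.AlgebraicComplexity
open Summit.ValiantsHypothesis.ValiantsHypothesis.Theses.PolyaContinued
open scoped Classical

/-- STUB 1 — THINNESS (repaired 2026-08-27, val-width-7421-p2: uniform threshold `n₀ ≤ n` added; the
original registration, without it, is refuted at `n = 1` by `Theorems/MonotoneCoverHard/Negative/
FewStateCutStubFalse.lean` — the balance window `[n/3, 2n/3]` is integer-free there): for all `n ≥ n₀`,
every label-bijective Pfaffian cover of `S_n` has a balanced vertex cut with quasi-polynomially few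
matching states (uniform exponent `c`).  The composition below only uses `n = 2^t ≥ t ≥ K ≥ n₀`. -/
theorem stub_fewStateCut :
    ∃ c n₀ : ℕ, ∀ (n m : ℕ) (E : Finset (Fin m × Fin m))
      (a : Fin m × Fin m → MvPolynomial (Fin n × Fin n) ℂ), n₀ ≤ n →
      (∃ s : Fin m × Fin m → ℂ, (∀ e, s e = 1 ∨ s e = -1) ∧
        (Matrix.of fun i j => if (i, j) ∈ E then MvPolynomial.C (s (i, j)) * MvPolynomial.X (i, j)
            else 0 : Matrix (Fin m) (Fin m) (MvPolynomial (Fin m × Fin m) ℂ)).det =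
          (Matrix.of fun i j => if (i, j) ∈ E then MvPolynomial.X (i, j) else 0 :
            Matrix (Fin m) (Fin m) (MvPolynomial (Fin m × Fin m) ℂ)).permanent) →
      (∀ e, (∃ j, a e = MvPolynomial.X j) ∨ a e = 0 ∨ a e = 1) →
      Literature.Computability.AlgebraicComplexity.perPoly (Fin n) ℂ =
        MvPolynomial.aeval a (Matrix.of fun i j => if (i, j) ∈ E then MvPolynomial.X (i, j) else 0 :
            Matrix (Fin m) (Fin m) (MvPolynomial (Fin m × Fin m) ℂ)).permanent →
      ∃ S : Finset (Fin m ⊕ Fin m),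
        (∀ τ : Equiv.Perm (Fin m), (∀ i, (i, τ i) ∈ E ∧ a (i, τ i) ≠ 0) →
          n ≤ 3 * (Finset.univ.filter fun i : Fin m =>
              Sum.inl i ∈ S ∧ Sum.inr (τ i) ∈ S ∧ ∃ j, a (i, τ i) = MvPolynomial.X j).card ∧
          3 * (Finset.univ.filter fun i : Fin m =>
              Sum.inl i ∈ S ∧ Sum.inr (τ i) ∈ S ∧ ∃ j, a (i, τ i) = MvPolynomial.X j).card ≤ 2 * n) ∧
        ((Finset.univ.filter fun τ : Equiv.Perm (Fin m) => ∀ i, (i, τ i) ∈ E ∧ a (i, τ i) ≠ 0).image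
            (fun τ : Equiv.Perm (Fin m) => (Finset.univ.filter fun i : Fin m =>
              (Sum.inl i ∈ S ∧ Sum.inr (τ i) ∉ S) ∨ (Sum.inl i ∉ S ∧ Sum.inr (τ i) ∈ S)).image
                fun i => (i, τ i))).card ≤ 2 ^ ((Nat.log 2 m + c) ^ c) := by
  sorry

/-- STUB 2 — RECTANGLE COUNTING: a balanced cut of a label-bijective Pfaffian cover of `S_n` has at least
`2^(n/3)` matching states. -/
theorem stub_rectangleBound :
    ∀ (n m : ℕ) (E : Finset (Fin m × Fin m))
      (a : Fin m × Fin m → MvPolynomial (Fin n × Fin n) ℂ),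
      (∃ s : Fin m × Fin m → ℂ, (∀ e, s e = 1 ∨ s e = -1) ∧
        (Matrix.of fun i j => if (i, j) ∈ E then MvPolynomial.C (s (i, j)) * MvPolynomial.X (i, j)
            else 0 : Matrix (Fin m) (Fin m) (MvPolynomial (Fin m × Fin m) ℂ)).det =
          (Matrix.of fun i j => if (i, j) ∈ E then MvPolynomial.X (i, j) else 0 :
            Matrix (Fin m) (Fin m) (MvPolynomial (Fin m × Fin m) ℂ)).permanent) →
      (∀ e, (∃ j, a e = MvPolynomial.X j) ∨ a e = 0 ∨ a e = 1) →
      Literature.Computability.AlgebraicComplexity.perPoly (Fin n) ℂ =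
        MvPolynomial.aeval a (Matrix.of fun i j => if (i, j) ∈ E then MvPolynomial.X (i, j) else 0 :
            Matrix (Fin m) (Fin m) (MvPolynomial (Fin m × Fin m) ℂ)).permanent →
      ∀ S : Finset (Fin m ⊕ Fin m),
        (∀ τ : Equiv.Perm (Fin m), (∀ i, (i, τ i) ∈ E ∧ a (i, τ i) ≠ 0) →
          n ≤ 3 * (Finset.univ.filter fun i : Fin m =>
              Sum.inl i ∈ S ∧ Sum.inr (τ i) ∈ S ∧ ∃ j, a (i, τ i) = MvPolynomial.X j).card ∧
          3 * (Finset.univ.filter fun i : Fin m =>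
              Sum.inl i ∈ S ∧ Sum.inr (τ i) ∈ S ∧ ∃ j, a (i, τ i) = MvPolynomial.X j).card ≤ 2 * n) →
        2 ^ (n / 3) ≤
          ((Finset.univ.filter fun τ : Equiv.Perm (Fin m) => ∀ i, (i, τ i) ∈ E ∧ a (i, τ i) ≠ 0).image
            (fun τ : Equiv.Perm (Fin m) => (Finset.univ.filter fun i : Fin m =>
              (Sum.inl i ∈ S ∧ Sum.inr (τ i) ∉ S) ∨ (Sum.inl i ∉ S ∧ Sum.inr (τ i) ∈ S)).image
                fun i => (i, τ i))).card := by
  sorry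

/-- Exponent bookkeeping (`qp ∘ qp = qp`): if `m ≤ 2^((L + c₀)^c₀)` then
`(Nat.log 2 m + c)^c ≤ (L + K)^K` with `K = (c₀ + 2) * c + c₀ + c + 2`. -/
theorem decancellation_exponent_le (L c₀ c m : ℕ) (hm : m ≤ 2 ^ ((L + c₀) ^ c₀)) :
    (Nat.log 2 m + c) ^ c ≤
      (L + ((c₀ + 2) * c + c₀ + c + 2)) ^ ((c₀ + 2) * c + c₀ + c + 2) := by
  set A := (L + c₀) ^ c₀ with hA
  set K := (c₀ + 2) * c + c₀ + c + 2 with hK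
  have hlog : Nat.log 2 m ≤ A := by
    calc Nat.log 2 m ≤ Nat.log 2 (2 ^ A) := Nat.log_mono_right hm
      _ = A := Nat.log_pow Nat.one_lt_two _
  set D := L + c₀ + c + 2 with hD
  have hD2 : 2 ≤ D := by omega
  have hD1 : 1 ≤ D := by omega
  have hAD : A ≤ D ^ (c₀ + 1) := by
    calc A = (L + c₀) ^ c₀ := hA
      _ ≤ D ^ c₀ := Nat.pow_le_pow_left (by omega) c₀
      _ ≤ D ^ c₀ * D := Nat.le_mul_of_pos_right _ (by omega)
      _ = D ^ (c₀ + 1) := (pow_succ D c₀).symm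
  have hcD : c ≤ D ^ (c₀ + 1) := by
    calc c ≤ D := by omega
      _ ≤ D ^ (c₀ + 1) := Nat.le_self_pow (by omega) D
  have hbase : Nat.log 2 m + c ≤ D ^ (c₀ + 2) := by
    calc Nat.log 2 m + c ≤ D ^ (c₀ + 1) + D ^ (c₀ + 1) := Nat.add_le_add (le_trans hlog hAD) hcD
      _ = 2 * D ^ (c₀ + 1) := (two_mul _).symm
      _ ≤ D * D ^ (c₀ + 1) := Nat.mul_le_mul_right _ hD2
      _ = D ^ (c₀ + 2) := by rw [mul_comm, ← pow_succ]
  have hDK : D ≤ L + K := by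
    have : c₀ + c + 2 ≤ K := by rw [hK]; omega
    omega
  have hLK : 1 ≤ L + K := le_trans hD1 hDK
  calc (Nat.log 2 m + c) ^ c ≤ (D ^ (c₀ + 2)) ^ c := Nat.pow_le_pow_left hbase c
    _ = D ^ ((c₀ + 2) * c) := by rw [← pow_mul]
    _ ≤ (L + K) ^ ((c₀ + 2) * c) := Nat.pow_le_pow_left hDK _
    _ ≤ (L + K) ^ K := Nat.pow_le_pow_right hLK (by rw [hK]; omega)

/-- `polylog < linear` at one explicit point: `(t + K)^K < 2^t / 3` for `t = 4K² + 8K + 4`. -/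
theorem polylog_lt_linear (K : ℕ) :
    (4 * K * K + 8 * K + 4 + K) ^ K < 2 ^ (4 * K * K + 8 * K + 4) / 3 := by
  set t := 4 * K * K + 8 * K + 4 with ht
  -- t + K ≤ (2K+3)² ≤ 2^(2K+3) · 2^(2K+3) = 2^(4K+6)
  have h1 : t + K ≤ (2 * K + 3) * (2 * K + 3) := by rw [ht]; nlinarith [Nat.zero_le K]
  have h2 : 2 * K + 3 ≤ 2 ^ (2 * K + 3) := (Nat.lt_two_pow_self).le
  have h3 : t + K ≤ 2 ^ (4 * K + 6) := by
    calc t + K ≤ (2 * K + 3) * (2 * K + 3) := h1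
      _ ≤ 2 ^ (2 * K + 3) * 2 ^ (2 * K + 3) := Nat.mul_le_mul h2 h2
      _ = 2 ^ (4 * K + 6) := by rw [← pow_add]; ring_nf
  have h4 : (t + K) ^ K ≤ 2 ^ ((4 * K + 6) * K) := by
    calc (t + K) ^ K ≤ (2 ^ (4 * K + 6)) ^ K := Nat.pow_le_pow_left h3 K
      _ = 2 ^ ((4 * K + 6) * K) := by rw [← pow_mul]
  -- ((t+K)^K + 1) * 3 ≤ 2^((4K+6)K + 3) ≤ 2^t
  have h5 : (4 * K + 6) * K + 3 ≤ t := by rw [ht]; nlinarith [Nat.zero_le K]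
  have h6 : ((t + K) ^ K + 1) * 3 ≤ 2 ^ t := by
    have hp : 1 ≤ 2 ^ ((4 * K + 6) * K) := Nat.one_le_two_pow
    calc ((t + K) ^ K + 1) * 3 ≤ (2 ^ ((4 * K + 6) * K) + 2 ^ ((4 * K + 6) * K)) * 4 :=
          Nat.mul_le_mul (Nat.add_le_add h4 hp) (by norm_num)
      _ = 2 ^ ((4 * K + 6) * K + 3) := by ring
      _ ≤ 2 ^ t := Nat.pow_le_pow_right Nat.two_pos h5
  have h7 : (t + K) ^ K + 1 ≤ 2 ^ t / 3 := (Nat.le_div_iff_mul_le (by norm_num)).2 h6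
  omega

/-- THE PIECE `MonotoneCoverHard` BY NAME from the two declared stubs.  With the threshold `n₀` of
`stub_fewStateCut` folded into `K := (c₀ + 2) c + c₀ + c + 2 + n₀`, the chain is
`2^(2^t / 3) ≤ N ≤ 2^((log₂ m + c)^c) ≤ 2^((t + K₀)^K₀) ≤ 2^((t + K)^K) < 2^(2^t / 3)`. -/
theorem MonotoneCoverHard_of : MonotoneCoverHard := by
  obtain ⟨c, n₀, hc⟩ := stub_fewStateCut
  rintro ⟨c₀, hc₀⟩
  set K := (c₀ + 2) * c + c₀ + c + 2 + n₀ with hK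
  set t := 4 * K * K + 8 * K + 4 with ht
  obtain ⟨m, hm, E, P, hP, ⟨s, hs, hdet⟩, a, ha, hper⟩ := hc₀ (2 ^ t)
  have hsig : ∃ s : Fin m × Fin m → ℂ, (∀ e, s e = 1 ∨ s e = -1) ∧
      (Matrix.of fun i j => if (i, j) ∈ E then MvPolynomial.C (s (i, j)) * MvPolynomial.X (i, j)
          else 0 : Matrix (Fin m) (Fin m) (MvPolynomial (Fin m × Fin m) ℂ)).det =
        (Matrix.of fun i j => if (i, j) ∈ E then MvPolynomial.X (i, j) else 0 :
          Matrix (Fin m) (Fin m) (MvPolynomial (Fin m × Fin m) ℂ)).permanent :=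
    ⟨s, hs, hdet.trans hP⟩
  have hper' : Literature.Computability.AlgebraicComplexity.perPoly (Fin (2 ^ t)) ℂ =
      MvPolynomial.aeval a (Matrix.of fun i j => if (i, j) ∈ E then MvPolynomial.X (i, j) else 0 :
          Matrix (Fin m) (Fin m) (MvPolynomial (Fin m × Fin m) ℂ)).permanent := by
    rw [hper, hP]
  -- the threshold: n₀ ≤ K ≤ t ≤ 2^t
  have hKt : K ≤ t := by rw [ht]; nlinarith [Nat.zero_le K]
  have hn₀ : n₀ ≤ 2 ^ t :=
    le_trans (by rw [hK]; omega) (le_trans hKt (Nat.lt_two_pow_self).le)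
  obtain ⟨S, hbal, hN⟩ := hc (2 ^ t) m E a hn₀ hsig ha hper'
  have hlow := stub_rectangleBound (2 ^ t) m E a hsig ha hper' S hbal
  -- 2^(2^t / 3) ≤ N ≤ 2^((log₂ m + c)^c) ≤ 2^((t + K)^K)
  have hlogn : Nat.log 2 (2 ^ t) = t := Nat.log_pow Nat.one_lt_two _
  have hexp : (Nat.log 2 m + c) ^ c ≤ (t + K) ^ K := by
    have h1 := decancellation_exponent_le t c₀ c m (by simpa [hlogn] using hm)
    have hK₀ : (c₀ + 2) * c + c₀ + c + 2 ≤ K := by rw [hK]; omega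
    have ht1 : 1 ≤ t + K := by rw [ht]; omega
    calc (Nat.log 2 m + c) ^ c
        ≤ (t + ((c₀ + 2) * c + c₀ + c + 2)) ^ ((c₀ + 2) * c + c₀ + c + 2) := h1
      _ ≤ (t + K) ^ ((c₀ + 2) * c + c₀ + c + 2) := Nat.pow_le_pow_left (by omega) _
      _ ≤ (t + K) ^ K := Nat.pow_le_pow_right ht1 hK₀
  have hchain : 2 ^ (2 ^ t / 3) ≤ 2 ^ ((t + K) ^ K) :=
    le_trans (le_trans hlow hN) (Nat.pow_le_pow_right Nat.two_pos hexp)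
  have hle : 2 ^ t / 3 ≤ (t + K) ^ K := (Nat.pow_le_pow_iff_right Nat.one_lt_two).1 hchain
  have hlt := polylog_lt_linear K
  rw [← ht] at hlt
  omega

end Summit.ValiantsHypothesis.ValiantsHypothesis.Cruxes.MonotoneCoverHard.FewStateCut
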